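import Literature.AlgebraicGeometry.Resolution.AlterationsStableModel
import Literature.AlgebraicGeometry.ModuliOfCurves.SemiStableCurves
import HarnessLib

/-!
# Bridge: the de Jong renderings of (pointed) semi-stable curves = the `ModuliOfCurves` leaf

Topic `Literature/AlgebraicGeometry/Resolution`. The three notions "ordinary double point over an
algebraically closed field" (de Jong 1996, 2.23), "semi-stable curve over a base" (2.21) and
"pointed semi-stable curve" (4.23, after Knudsen) are rendered twice in the tree, with the same
bodies: inside the alteration chain as `Resolution.IsOrdinaryDoublePoint`,
`Resolution.IsSemiStableCurve` (`AlterationsSemiStable.lean`) and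
`Resolution.DeJong1996.IsPointedSemiStableCurve` (`AlterationsStableModel.lean`), and in the
Mathlib-only leaf `ModuliOfCurves/SemiStableCurves.lean` that the moduli theory of stable curves
is typed over (so that its consumers do not import the alteration theorem's named facts). This
file, which imports both sides, records that they agree: `Iff.rfl` for the ordinary double
point, field-wise transport for the two structures. Nothing else is here.

## References

* A. J. de Jong, *Smoothness, semi-stability and alterations*, Publ. Math. IHÉS 83 (1996) 51–93:
  2.21, 2.23 (pp. 61–62), 4.23 (p. 75).
-/

noncomputable section

open CategoryTheory CategoryTheory.Limits AlgebraicGeometry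

namespace Literature.AlgebraicGeometry.Resolution

universe u

/-- The two renderings of "ordinary double point" (de Jong 1996, 2.23) agree definitionally.
[folklore] -/
theorem isOrdinaryDoublePoint_iff_moduliOfCurves (K : Type u) [Field K] {C : Scheme.{u}} (x : C) :
    IsOrdinaryDoublePoint K x ↔ ModuliOfCurves.IsOrdinaryDoublePoint K x :=
  Iff.rfl

/-- The two renderings of "semi-stable curve over a base" (de Jong 1996, 2.21) agree.
[folklore] -/
theorem isSemiStableCurve_iff_moduliOfCurves {X S : Scheme.{u}} (f : X ⟶ S) :
    IsSemiStableCurve f ↔ ModuliOfCurves.IsSemiStableCurve f :=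
  ⟨fun h => ⟨h.flat, h.isProper, h.locallyOfFinitePresentation, h.connectedSpace_pullback,
      h.isRegularLocalRing_or_isOrdinaryDoublePoint⟩,
    fun h => ⟨h.flat, h.isProper, h.locallyOfFinitePresentation, h.connectedSpace_pullback,
      h.isRegularLocalRing_or_isOrdinaryDoublePoint⟩⟩

/-- The two renderings of "pointed semi-stable curve" (de Jong 1996, 4.23) agree. [folklore] -/
theorem DeJong1996.isPointedSemiStableCurve_iff_moduliOfCurves {C S : Scheme.{u}} (p : C ⟶ S)
    {n : ℕ} (τ : Fin n → (S ⟶ C)) :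
    DeJong1996.IsPointedSemiStableCurve p τ ↔ ModuliOfCurves.IsPointedSemiStableCurve p τ :=
  ⟨fun h => ⟨(isSemiStableCurve_iff_moduliOfCurves p).1 h.isSemiStableCurve, h.comp_eq_id,
      h.pairwise_disjoint, h.exists_smooth⟩,
    fun h => ⟨(isSemiStableCurve_iff_moduliOfCurves p).2 h.isSemiStableCurve, h.comp_eq_id,
      h.pairwise_disjoint, h.exists_smooth⟩⟩

end Literature.AlgebraicGeometry.Resolution

end
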